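import Literature.NumberTheory.Automorphic.SLTwoTreeQuadraticTorusShellIndex   -- ★ part III (A-p17 (g23), R1LL-WILD (W′1)) p843948: `exists_shellIndex`, `glVertexAct_torus_eq_self_iff_le_shellIndex`
import HarnessLib

/-!
# The non-split quadratic torus on the tree of `SL₂(F)`, IV: the SEAM ADAPTERS for the weighted unfolding (shell representatives as a function, the
# `hshell` ∕ `hN` binders of ★ `FixedPointsShellValueLaw`, odd torus elements fix no vertex) (Labesse–Langlands 1979, §2 p. 8)

Topic `NumberTheory/Automorphic`; namespace `Literature.NumberTheory.Automorphic.HermitianLatticeTree` (ROAD W's).  KERNEL mathematics only: theorems, no definition, no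
named fact, no instance, no notation, no `sorry`.  Cell `pub/hodgecm-mathlib` (D-0151), crux H413 = `stmt-HodgeConjecture-24833`, line «N6nsGerm», road «W′» = «R1LL-WILD»
(LEAD F0P3a-plan (g10) WORD T9-25; architect A-p16 (g28), census `F0/P3a/A-p16/g28/CENSUS-Wprime.v1.A-p16g28.md`); brick (W′1) «THE TORUS IN THE TREE», part IV; seat
A-p17 (g23).  Parts I–III = ★ p843889 (fixed shells), ★ p843931 (shell decomposition), ★ p843948 (shell index function, `Fix(γ)` = ball).  THIS PART types the binders of
B-p14 (g33)'s ★ seam `Literature/GroupTheory/FixedPointsShellValueLaw.lean` p843939 (`hshell`, `hN`, representatives `r : ℕ → Γ`) on the tree side, so that the shell sum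
`Σ_{i ≤ N} #{x ∈ Fix(γ) | d x = i} • φ (r_i⁻¹ γ r_i)` is reached from (W′1) by `exact`.
HONEST LABEL: HC_CM is proved only modulo the cell's 2 remaining named inputs (hLiu418, h413) until rung 0 closes; nothing printed is asserted here — elementary lattice
algebra over a discrete valuation ring.

THE MATHEMATICS (notation of parts I–III: vertex type `V`, root `v₀ = 𝒪²`, action ★ `glVertexAct hϖ`, torus `T = {(c, ev; e, c + eu)}`, `τ² = uτ + v`, shell index `d`).
* §8 `exists_shellRep_fn`: the shell representatives as ONE function `r : ℕ → GL₂(F)`, `↑(r m) = diag(1, ϖ^m)` (B-p14's `r`).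
* §9 `exists_torus_comm_glVertexAct_shellRep_eq`: **the `hshell` binder** — every vertex `x` (fixed or not) is `t · r (d x) · v₀` with `t` a torus element, and `t` COMMUTES
  with every torus `γ` (★ `quadTorus_mul_comm`).
* §10 `glVertexAct_torus_eq_self_iff_shellIndex_le`: for a unit `γ = a + bτ` with `|b| = |ϖ|^n` (`b ≠ 0`): **`γ · x = x ⟺ d x ≤ n`** — the `hN` binder (`Fix(γ)` lies in
  the shells `≤ n = ord b`) together with its converse (the shells `≤ n` ARE fixed: `#{x ∈ Fix(γ) | d x = i} = #{x | d x = i}` for `i ≤ n`, `= 0` for `i > n` —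
  `setOf_glVertexAct_torus_eq_self_sep_shellIndex_eq`).
* §11 `glVertexAct_ne_self_of_valuation_det_eq`: an element with `|det γ| = |ϖ|` (at a RAMIFIED place: a uniformiser of `E` in the torus, e.g. `τ` of `√π`-type) moves
  EVERY vertex — it swaps the two vertex types (★ `glVertexAct_coe_of_valuation_det_eq_of_isSelfDual` ∕ `_of_isModular` + ★ `not_isModularLattice_of_isSelfDualLattice`);
  so the odd part of `T ∕ F^×` contributes nothing to vertex-unfolded orbital integrals (it inverts the base edge).
NOT here: shell CARDINALITIES `#{x | d x = m}` (LL's `δ_m = 2q^m` at a ramified place, `(q+1)q^{m−1}` unramified) and the finiteness `hfin` of `Fix(γ)` over a finite residue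
field — the remaining (W′1)-side inputs of the shell sum; cut on the architect's word after (W′0).

## References
* [LabesseLanglands1979] J.-P. Labesse, R. P. Langlands, *L-indistinguishability for SL(2)*, Canad. J. Math. 31 (1979), §2 p. 8 (representatives `diag(1, ϖ^m)`, `δ_m`).
* [Serre1980Trees] J.-P. Serre, *Trees* (1980), Ch. II §1.1 Theorem 1, §1.2–§1.3 (two vertex types; `GL₂` acts with inversions).
-/

set_option autoImplicit false

noncomputable section

open scoped ValuativeRel Matrix MatrixGroups
open Matrix ValuativeRel

namespace Literature.NumberTheory.Automorphic.HermitianLatticeTree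

open Literature.NumberTheory.Automorphic Literature.NumberTheory.LocalFields

variable {F : Type*} [Field F] [ValuativeRel F] {ϖ : F} (hϖ : IsUniformizingElement ϖ) [IsDiscreteValuationRing 𝒪[F]]

/-! ## §8 Shell representatives as a function -/

omit [ValuativeRel F] [IsDiscreteValuationRing 𝒪[F]] in
/-- **The shell representatives `r m = diag(1, ϖ^m)` as ONE function `ℕ → GL₂(F)`** (`ϖ ≠ 0`). [cite: LabesseLanglands1979, §2 p. 8] -/
theorem exists_shellRep_fn (h0 : ϖ ≠ 0) : ∃ r : ℕ → GL (Fin 2) F, ∀ m, (r m : Matrix (Fin 2) (Fin 2) F) = Matrix.diagonal ![1, ϖ ^ m] := by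
  have hdet : ∀ m : ℕ, (Matrix.diagonal ![(1 : F), ϖ ^ m]).det ≠ 0 := fun m => by
    rw [Matrix.det_diagonal, Fin.prod_univ_two]; simp [pow_ne_zero m h0]
  exact ⟨fun m => Matrix.GeneralLinearGroup.mk'' _ (isUnit_iff_ne_zero.2 (hdet m)), fun m => rfl⟩

/-! ## §9 The `hshell` binder: every vertex is `t · r (d x) · v₀` with `t` in the centraliser of the torus -/

include hϖ in
/-- **THE `hshell` BINDER of ★ `FixedPointsShellValueLaw`** on the tree of `SL₂(F)`: with `d` the shell index (property (i) of ★ `exists_shellIndex`) and `r` the shell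
representatives, EVERY vertex `x` is `t · r (d x) · v₀` for a torus element `t`, which commutes with the torus element `γ`. [cite: LabesseLanglands1979, §2 p. 8] -/
theorem exists_torus_comm_glVertexAct_shellRep_eq {u v a b : F} {γ : GL (Fin 2) F} (hγ : (γ : Matrix (Fin 2) (Fin 2) F) = !![a, b * v; b, a + b * u])
    (v₀ : {M : Submodule 𝒪[F] (Fin 2 → F) // IsSpecialLattice (RingHom.id F) ϖ !![(0 : F), 1; -1, 0] M})
    {d : {M : Submodule 𝒪[F] (Fin 2 → F) // IsSpecialLattice (RingHom.id F) ϖ !![(0 : F), 1; -1, 0] M} → ℕ}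
    (hd : ∀ x, ∃ (t gm : GL (Fin 2) F) (c e : F), (t : Matrix (Fin 2) (Fin 2) F) = !![c, e * v; e, c + e * u] ∧
      (gm : Matrix (Fin 2) (Fin 2) F) = Matrix.diagonal ![1, ϖ ^ d x] ∧ x = glVertexAct hϖ (t * gm) v₀)
    {r : ℕ → GL (Fin 2) F} (hr : ∀ m, (r m : Matrix (Fin 2) (Fin 2) F) = Matrix.diagonal ![1, ϖ ^ m])
    (x : {M : Submodule 𝒪[F] (Fin 2 → F) // IsSpecialLattice (RingHom.id F) ϖ !![(0 : F), 1; -1, 0] M}) :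
    ∃ t : GL (Fin 2) F, t * γ = γ * t ∧ glVertexAct hϖ (t * r (d x)) v₀ = x := by
  obtain ⟨t, gm, c, e, ht, hgm, hx⟩ := hd x
  have hgm' : gm = r (d x) := Units.ext (by rw [hgm, hr])
  exact ⟨t, (quadTorus_mul_comm hγ ht).symm, by rw [← hgm', ← hx]⟩

include hϖ in
/-- The same with the torus shape of `t` recorded (for consumers who read the class of `t⁻¹ γ t = γ` at the representative). [cite: LabesseLanglands1979, §2 p. 8] -/
theorem exists_torus_glVertexAct_shellRep_eq {u v : F}
    (v₀ : {M : Submodule 𝒪[F] (Fin 2 → F) // IsSpecialLattice (RingHom.id F) ϖ !![(0 : F), 1; -1, 0] M})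
    {d : {M : Submodule 𝒪[F] (Fin 2 → F) // IsSpecialLattice (RingHom.id F) ϖ !![(0 : F), 1; -1, 0] M} → ℕ}
    (hd : ∀ x, ∃ (t gm : GL (Fin 2) F) (c e : F), (t : Matrix (Fin 2) (Fin 2) F) = !![c, e * v; e, c + e * u] ∧
      (gm : Matrix (Fin 2) (Fin 2) F) = Matrix.diagonal ![1, ϖ ^ d x] ∧ x = glVertexAct hϖ (t * gm) v₀)
    {r : ℕ → GL (Fin 2) F} (hr : ∀ m, (r m : Matrix (Fin 2) (Fin 2) F) = Matrix.diagonal ![1, ϖ ^ m])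
    (x : {M : Submodule 𝒪[F] (Fin 2 → F) // IsSpecialLattice (RingHom.id F) ϖ !![(0 : F), 1; -1, 0] M}) :
    ∃ (t : GL (Fin 2) F) (c e : F), (t : Matrix (Fin 2) (Fin 2) F) = !![c, e * v; e, c + e * u] ∧ glVertexAct hϖ (t * r (d x)) v₀ = x := by
  obtain ⟨t, gm, c, e, ht, hgm, hx⟩ := hd x
  have hgm' : gm = r (d x) := Units.ext (by rw [hgm, hr])
  exact ⟨t, c, e, ht, by rw [← hgm', ← hx]⟩

/-! ## §10 The `hN` binder: `Fix(γ)` lies in the shells `≤ ord b`, and conversely -/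

include hϖ in
/-- **`γ · x = x ⟺ d x ≤ n`** for a unit `γ = (a, bv; b, a+bu)` of the order with `|b| = |ϖ|^n` (`a b u v ∈ 𝒪`, `|det γ| = 1`), `d` the shell index: the fixed set is
EXACTLY the union of the shells `0, …, n` (the ball of radius `n = ord b` about the facet of the torus).  «⇒» is the `hN` binder of ★ `FixedPointsShellValueLaw`.
[cite: LabesseLanglands1979, §2 p. 8] [cite: Serre1980Trees, Ch. II §1.3] -/
theorem glVertexAct_torus_eq_self_iff_shellIndex_le {u v a b : F} (hu : u ∈ 𝒪[F]) (hv : v ∈ 𝒪[F]) (ha : a ∈ 𝒪[F]) (hb : b ∈ 𝒪[F]) {n : ℕ}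
    (hbn : valuation F b = valuation F ϖ ^ n)
    {γ : GL (Fin 2) F} (hγ : (γ : Matrix (Fin 2) (Fin 2) F) = !![a, b * v; b, a + b * u]) (hγdet : valuation F (γ : Matrix (Fin 2) (Fin 2) F).det = 1)
    (v₀ : {M : Submodule 𝒪[F] (Fin 2 → F) // IsSpecialLattice (RingHom.id F) ϖ !![(0 : F), 1; -1, 0] M})
    (hv₀ : v₀.1 = latt (1 : Matrix (Fin 2) (Fin 2) F))
    {d : {M : Submodule 𝒪[F] (Fin 2 → F) // IsSpecialLattice (RingHom.id F) ϖ !![(0 : F), 1; -1, 0] M} → ℕ}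
    (hd : ∀ x, ∃ (t gm : GL (Fin 2) F) (c e : F), (t : Matrix (Fin 2) (Fin 2) F) = !![c, e * v; e, c + e * u] ∧
      (gm : Matrix (Fin 2) (Fin 2) F) = Matrix.diagonal ![1, ϖ ^ d x] ∧ x = glVertexAct hϖ (t * gm) v₀)
    (x : {M : Submodule 𝒪[F] (Fin 2 → F) // IsSpecialLattice (RingHom.id F) ϖ !![(0 : F), 1; -1, 0] M}) :
    glVertexAct hϖ γ x = x ↔ d x ≤ n := by
  rw [glVertexAct_torus_eq_self_iff_le_shellIndex hϖ hu hv ha hb hγ hγdet v₀ hv₀ hd x, hbn]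
  exact pow_le_pow_iff_right_of_lt_one₀ ((Valuation.pos_iff _).2 hϖ.ne_zero) hϖ.valuation_lt_one

include hϖ in
/-- **The `hN` binder** of ★ `FixedPointsShellValueLaw`: every `γ`-fixed vertex has shell index `≤ n = ord b`. [cite: LabesseLanglands1979, §2 p. 8] -/
theorem shellIndex_le_of_glVertexAct_torus_eq_self {u v a b : F} (hu : u ∈ 𝒪[F]) (hv : v ∈ 𝒪[F]) (ha : a ∈ 𝒪[F]) (hb : b ∈ 𝒪[F]) {n : ℕ}
    (hbn : valuation F b = valuation F ϖ ^ n)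
    {γ : GL (Fin 2) F} (hγ : (γ : Matrix (Fin 2) (Fin 2) F) = !![a, b * v; b, a + b * u]) (hγdet : valuation F (γ : Matrix (Fin 2) (Fin 2) F).det = 1)
    (v₀ : {M : Submodule 𝒪[F] (Fin 2 → F) // IsSpecialLattice (RingHom.id F) ϖ !![(0 : F), 1; -1, 0] M})
    (hv₀ : v₀.1 = latt (1 : Matrix (Fin 2) (Fin 2) F))
    {d : {M : Submodule 𝒪[F] (Fin 2 → F) // IsSpecialLattice (RingHom.id F) ϖ !![(0 : F), 1; -1, 0] M} → ℕ}
    (hd : ∀ x, ∃ (t gm : GL (Fin 2) F) (c e : F), (t : Matrix (Fin 2) (Fin 2) F) = !![c, e * v; e, c + e * u] ∧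
      (gm : Matrix (Fin 2) (Fin 2) F) = Matrix.diagonal ![1, ϖ ^ d x] ∧ x = glVertexAct hϖ (t * gm) v₀)
    (x : {M : Submodule 𝒪[F] (Fin 2 → F) // IsSpecialLattice (RingHom.id F) ϖ !![(0 : F), 1; -1, 0] M}) (hx : glVertexAct hϖ γ x = x) : d x ≤ n :=
  (glVertexAct_torus_eq_self_iff_shellIndex_le hϖ hu hv ha hb hbn hγ hγdet v₀ hv₀ hd x).1 hx

include hϖ in
/-- **The fixed part of each shell**: for `i ≤ n` the whole shell `i` is fixed, for `i > n` none of it —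
`{x | γ · x = x ∧ d x = i} = if i ≤ n then {x | d x = i} else ∅` (so the coefficients of the shell sum are `#{x | d x = i}` for `i ≤ n` and `0` beyond).
[cite: LabesseLanglands1979, §2 p. 8] -/
theorem setOf_glVertexAct_torus_eq_self_sep_shellIndex_eq {u v a b : F} (hu : u ∈ 𝒪[F]) (hv : v ∈ 𝒪[F]) (ha : a ∈ 𝒪[F]) (hb : b ∈ 𝒪[F]) {n : ℕ}
    (hbn : valuation F b = valuation F ϖ ^ n)
    {γ : GL (Fin 2) F} (hγ : (γ : Matrix (Fin 2) (Fin 2) F) = !![a, b * v; b, a + b * u]) (hγdet : valuation F (γ : Matrix (Fin 2) (Fin 2) F).det = 1)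
    (v₀ : {M : Submodule 𝒪[F] (Fin 2 → F) // IsSpecialLattice (RingHom.id F) ϖ !![(0 : F), 1; -1, 0] M})
    (hv₀ : v₀.1 = latt (1 : Matrix (Fin 2) (Fin 2) F))
    {d : {M : Submodule 𝒪[F] (Fin 2 → F) // IsSpecialLattice (RingHom.id F) ϖ !![(0 : F), 1; -1, 0] M} → ℕ}
    (hd : ∀ x, ∃ (t gm : GL (Fin 2) F) (c e : F), (t : Matrix (Fin 2) (Fin 2) F) = !![c, e * v; e, c + e * u] ∧
      (gm : Matrix (Fin 2) (Fin 2) F) = Matrix.diagonal ![1, ϖ ^ d x] ∧ x = glVertexAct hϖ (t * gm) v₀) (i : ℕ) :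
    {x | glVertexAct hϖ γ x = x ∧ d x = i} = if i ≤ n then {x | d x = i} else ∅ := by
  ext x
  simp only [Set.mem_setOf_eq, glVertexAct_torus_eq_self_iff_shellIndex_le hϖ hu hv ha hb hbn hγ hγdet v₀ hv₀ hd x]
  split_ifs with h
  · simp only [Set.mem_setOf_eq]
    exact ⟨fun hx => hx.2, fun hx => ⟨hx ▸ h, hx⟩⟩
  · simp only [Set.mem_empty_iff_false, iff_false, not_and]
    intro hle hi
    exact h (hi ▸ hle)

/-! ## §11 Odd torus elements fix no vertex -/

include hϖ in
/-- **AN ELEMENT WITH `|det γ| = |ϖ|` MOVES EVERY VERTEX** of the tree of `SL₂(F)`: it maps self-dual lattices to `ϖ`-modular ones and vice versa (★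
`glVertexAct_coe_of_valuation_det_eq_of_isSelfDual` ∕ `_of_isModular`), and no lattice has both types (★ `not_isModularLattice_of_isSelfDualLattice`).  At a RAMIFIED
place the torus `E^×` contains such elements (uniformisers of `E`, norm of odd valuation): they invert the base edge and contribute NO fixed vertex. [cite: Serre1980Trees,
Ch. II §1.2–§1.3] [cite: LabesseLanglands1979, §2 p. 8] -/
theorem glVertexAct_ne_self_of_valuation_det_eq {γ : GL (Fin 2) F} (hγ : valuation F (γ : Matrix (Fin 2) (Fin 2) F).det = valuation F ϖ)
    (x : {M : Submodule 𝒪[F] (Fin 2 → F) // IsSpecialLattice (RingHom.id F) ϖ !![(0 : F), 1; -1, 0] M}) : glVertexAct hϖ γ x ≠ x := by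
  intro h
  have h0 := hϖ.ne_zero
  rcases x.2 with hx | hx
  · -- `x` self-dual, `γ · x = γ x` is modular
    have hcoe := glVertexAct_coe_of_valuation_det_eq_of_isSelfDual hϖ hγ x hx
    rw [h] at hcoe
    have hmod : IsModularLattice (RingHom.id F) ϖ !![(0 : F), 1; -1, 0] x.1 := by
      rw [hcoe]; exact isModularLattice_mapGL_of_valuation_det_eq h0 hγ hx
    exact not_isModularLattice_of_isSelfDualLattice (RingHom.id F) (fun _ => rfl) hϖ _ hx hmod
  · -- `x` modular, `γ · x = ϖ⁻¹ γ x` is self-dual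
    have hcoe := glVertexAct_coe_of_valuation_det_eq_of_isModular hϖ hγ x hx
    rw [h] at hcoe
    have hsd : IsSelfDualLattice (RingHom.id F) !![(0 : F), 1; -1, 0] x.1 := by
      rw [hcoe]; exact isSelfDualLattice_scaleLattice_inv_mapGL_of_valuation_det_eq h0 hγ hx
    exact not_isModularLattice_of_isSelfDualLattice (RingHom.id F) (fun _ => rfl) hϖ _ hsd hx

include hϖ in
/-- Hence such a `γ` has NO fixed vertex: `{x | γ · x = x} = ∅`. [cite: Serre1980Trees, Ch. II §1.3] -/
theorem setOf_glVertexAct_eq_self_eq_empty_of_valuation_det_eq {γ : GL (Fin 2) F} (hγ : valuation F (γ : Matrix (Fin 2) (Fin 2) F).det = valuation F ϖ) :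
    {x : {M : Submodule 𝒪[F] (Fin 2 → F) // IsSpecialLattice (RingHom.id F) ϖ !![(0 : F), 1; -1, 0] M} | glVertexAct hϖ γ x = x} = ∅ :=
  Set.eq_empty_of_forall_notMem fun x hx => glVertexAct_ne_self_of_valuation_det_eq hϖ hγ x hx

end Literature.NumberTheory.Automorphic.HermitianLatticeTree

end
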